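import Summits.HubbardSuperconductivity.HubbardLadder.Bounds.StiffnessCeilingTPrime
import Summits.HubbardSuperconductivity.HubbardLadder.Bounds.ThermalStiffnessCeilingTPrime
import Summits.HubbardSuperconductivity.HubbardLadder.Bounds.BandwidthExtremiser
import Literature.Probability.LatticeModels.LipschitzRiemannSum
import HarnessLib

/-!
# The half-bathtub stiffness ceiling in the thermodynamic limit (pub-hubbard BOUNDS; proved)

HONEST FRAMING: ladder R1–R4 with certified numbers; no claim on H/H₀. Bounds for a MODEL CLASS
(the `t–t'` Hubbard torus `hubbardTorusTT' L 1 t' U` on `(ℤ/L)²`, every `t'`, `U`, filling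
`n = 1 - δ ∈ [0, 2]`, every temperature), no materials claim.

The landed finite-torus ceilings `HalfBathtubStiffnessBoundTT'` (`T = 0`,
`Bounds/StiffnessCeilingTPrime.lean`) and `ThermalHalfBathtubStiffnessBoundTT'` (`T > 0`,
`Bounds/ThermalStiffnessCeilingTPrime.lean`) bound an admissible stiffness coefficient by the
lattice sum `ρ_s L² ≤ ν N_L/2 + Σ_{k ∈ (2π/L)ℤ²_L} (cos k₁ + cos k₂ + 4t' cos k₁ cos k₂ − ν)⁺`.
This file PROVES their thermodynamic-limit form WITH AN EXPLICIT RATE (bounds.tex Cor. 2.2(iii) /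
Remark 2.5, so far "paper-only"): for every `L ≥ 3`, `t'`, `U`, `-1 ≤ δ ≤ 1`, `ν`,

  `ρ_s ≤ ν(1-δ)/2 + (4π²)⁻¹ ∫_{-π}^{π}∫_{-π}^{π} (cos x + cos y + 4t' cos x cos y − ν)⁺ dx dy
        + (|ν| + 2π(1 + 4|t'|))/L`                         (`HalfBathtubStiffnessBoundTL`),

the same at `T > 0` (`ThermalHalfBathtubStiffnessBoundTL`), and the headline at half filling
(`δ = 0`, `ν = 0`, where `∫∫ (w/2)⁺ = π² · kinL1 t'` because `∫∫ w = 0`):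
`ρ_s ≤ kinL1 t' / 4 + 2π(1 + 4|t'|)/L` (`HalfFillingStiffnessCeilingTL`), i.e. at `t' = 0`
(`kinL1 0 = 16/π²`, tree `kinL1_zero`) **`ρ_s ≤ 4/π² + 2π/L` for the half-filled Hubbard torus at
every `U`** (`HalfFillingStiffnessCeilingHubbardTL`). With the Nelson–Kosterlitz reading
(`k_B T_c ≤ (π/2) ρ_s`, hypothesis NK of BOUNDS.md, not a theorem) this is the kernel form of
`k_B T_c ≤ 2t/π + O(t/L)` at `n = 1` (HVR19 eq. (3) with the sharp one-body constant).

The analytic input is the Riemann-sum estimate for periodic Lipschitz functions on the Brillouin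
torus, `Literature/Probability/LatticeModels/LipschitzRiemannSum.lean`
(`abs_sum_torusSite_two_sub_integral_le`: `|Σ_k f(p_k) − L²/(4π²)∫∫ f| ≤ 2πKL`), applied to the
positive part of the shifted symbol, which is `(1 + 4|t'|)`-Lipschitz in each momentum; plus the
particle-number bookkeeping `ν N_L/2 ≤ ν(1-δ)L²/2 + |ν|`.

Deliberately NOT here: the optimisation over `ν` (the value `s_w(n, t')/2` of EXTREMISERS.md §2 is
an interval-certified NUMBER, not a kernel term), and any `L → ∞` limit statement (the explicit rate
makes `Filter.limsup` bookkeeping unnecessary: every finite `L ≥ 3` is covered).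

References: HazraVermaRanderia2019 eqs. (2)–(6); ParamekantiTrivediRanderia1998 eq. (3);
ScalapinoWhiteZhang1993 §II; bounds.tex Thm 1, Cor. 2.2, Rem. 2.5.
-/

noncomputable section

namespace Summit.HubbardSuperconductivity.HubbardLadder.Bounds

open Finset Real MeasureTheory Matrix
open Literature.MathematicalPhysics.QuantumLattice Literature.MathematicalPhysics.QuantumFieldTheory
  Literature.Probability.LatticeModels
open scoped ComplexConjugate ComplexOrder

/-! ### The shifted symbol and its positive part -/

/-- The positive part of the shifted `t–t'` kinetic symbol (half the tree's `kinSymbol t'` minus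
the level `ν`): `(cos x + cos y + 4t' cos x cos y − ν)⁺`. -/
def bathtubSymbolTT' (t' ν x y : ℝ) : ℝ :=
  max (Real.cos x + Real.cos y + 4 * t' * (Real.cos x * Real.cos y) - ν) 0

/-- `x ↦ (…)⁺` is `2π`-periodic. -/
theorem bathtubSymbolTT'_periodic_left (t' ν y : ℝ) :
    Function.Periodic (fun x => bathtubSymbolTT' t' ν x y) (2 * π) := fun x => by
  simp only [bathtubSymbolTT', Real.cos_add_two_pi]

/-- `y ↦ (…)⁺` is `2π`-periodic. -/
theorem bathtubSymbolTT'_periodic_right (t' ν x : ℝ) :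
    Function.Periodic (bathtubSymbolTT' t' ν x) (2 * π) := fun y => by
  simp only [bathtubSymbolTT', Real.cos_add_two_pi]

/-- The symbol is symmetric in its two momenta. -/
theorem bathtubSymbolTT'_comm (t' ν x y : ℝ) :
    bathtubSymbolTT' t' ν x y = bathtubSymbolTT' t' ν y x := by
  simp only [bathtubSymbolTT']; ring_nf

/-- `(1 + 4|t'|)`-Lipschitz in the first momentum:
`|(…)⁺(x) − (…)⁺(x')| ≤ (1 + 4|t'|)|x − x'|`. -/
theorem abs_bathtubSymbolTT'_sub_le_left (t' ν x x' y : ℝ) :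
    |bathtubSymbolTT' t' ν x y - bathtubSymbolTT' t' ν x' y| ≤ (1 + 4 * |t'|) * |x - x'| := by
  unfold bathtubSymbolTT'
  refine (abs_max_sub_max_le_abs _ _ _).trans ?_
  have hcos := Real.abs_cos_sub_cos_le x x'
  have hcy : |Real.cos y| ≤ 1 := Real.abs_cos_le_one y
  rw [show Real.cos x + Real.cos y + 4 * t' * (Real.cos x * Real.cos y) - ν -
      (Real.cos x' + Real.cos y + 4 * t' * (Real.cos x' * Real.cos y) - ν) =
      (Real.cos x - Real.cos x') * (1 + 4 * t' * Real.cos y) by ring, abs_mul]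
  have h2 : |1 + 4 * t' * Real.cos y| ≤ 1 + 4 * |t'| := by
    refine (abs_add_le _ _).trans ?_
    rw [abs_one, abs_mul, abs_mul, show |(4 : ℝ)| = 4 by norm_num]
    nlinarith [abs_nonneg t']
  calc |Real.cos x - Real.cos x'| * |1 + 4 * t' * Real.cos y|
      ≤ |x - x'| * (1 + 4 * |t'|) := mul_le_mul hcos h2 (abs_nonneg _) (abs_nonneg _)
    _ = (1 + 4 * |t'|) * |x - x'| := mul_comm _ _

/-- `(1 + 4|t'|)`-Lipschitz in the second momentum. -/
theorem abs_bathtubSymbolTT'_sub_le_right (t' ν x y y' : ℝ) :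
    |bathtubSymbolTT' t' ν x y - bathtubSymbolTT' t' ν x y'| ≤ (1 + 4 * |t'|) * |y - y'| := by
  rw [bathtubSymbolTT'_comm t' ν x y, bathtubSymbolTT'_comm t' ν x y']
  exact abs_bathtubSymbolTT'_sub_le_left t' ν y y' x

/-- **The lattice sum of the positive-part symbol against its zone integral**:
`Σ_k (…)⁺ ≤ L²/(4π²) · ∫∫ (…)⁺ + 2π(1 + 4|t'|) L` (Literature
`abs_sum_torusSite_two_sub_integral_le`, upper half). -/
theorem sum_bathtubSymbolTT'_le (t' ν : ℝ) (L : ℕ) [NeZero L] :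
    ∑ k : TorusSite 2 L, bathtubSymbolTT' t' ν (latticeMomentum L k 0) (latticeMomentum L k 1) ≤
      (L : ℝ) ^ 2 / (4 * π ^ 2) * bzInt (bathtubSymbolTT' t' ν) +
        2 * π * (1 + 4 * |t'|) * L := by
  have hK : (0 : ℝ) ≤ 1 + 4 * |t'| := by positivity
  have h2 : |∑ k : TorusSite 2 L, bathtubSymbolTT' t' ν (latticeMomentum L k 0)
      (latticeMomentum L k 1) - (L : ℝ) ^ 2 / (4 * π ^ 2) * bzInt (bathtubSymbolTT' t' ν)| ≤
      2 * π * (1 + 4 * |t'|) * L :=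
    abs_sum_torusSite_two_sub_integral_le hK (bathtubSymbolTT'_periodic_left t' ν)
      (bathtubSymbolTT'_periodic_right t' ν) (abs_bathtubSymbolTT'_sub_le_left t' ν)
      (abs_bathtubSymbolTT'_sub_le_right t' ν) L
  linarith [(abs_sub_le_iff.1 h2).1]

/-- The electron number `N_L = 2⌊(1-δ)L²/2⌋₊` against the filling density:
`ν N_L / 2 ≤ ν (1-δ) L²/2 + |ν|` for `δ ≤ 1` and every real `ν`. -/
theorem nu_mul_particleNumber_le (L : ℕ) {δ : ℝ} (hδ : δ ≤ 1) (ν : ℝ) :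
    ν * ((2 * ⌊(1 - δ) * (L : ℝ) ^ 2 / 2⌋₊ : ℕ) : ℝ) / 2 ≤
      ν * (1 - δ) * (L : ℝ) ^ 2 / 2 + |ν| := by
  have hnn : 0 ≤ (1 - δ) * (L : ℝ) ^ 2 / 2 := by
    have : 0 ≤ 1 - δ := by linarith
    positivity
  have hfl : (⌊(1 - δ) * (L : ℝ) ^ 2 / 2⌋₊ : ℝ) ≤ (1 - δ) * (L : ℝ) ^ 2 / 2 := Nat.floor_le hnn
  have hlt : (1 - δ) * (L : ℝ) ^ 2 / 2 < (⌊(1 - δ) * (L : ℝ) ^ 2 / 2⌋₊ : ℝ) + 1 :=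
    Nat.lt_floor_add_one _
  push_cast
  rcases le_or_gt 0 ν with hν | hν
  · rw [abs_of_nonneg hν]; nlinarith
  · rw [abs_of_neg hν]; nlinarith

/-- **The finite-torus right-hand side against its thermodynamic limit** (`L ≥ 1`, `δ ≤ 1`):
`ν N_L/2 + Σ_k (…)⁺ ≤ L² · (ν(1-δ)/2 + (4π²)⁻¹∫∫(…)⁺ + (|ν| + 2π(1+4|t'|))/L)`. -/
theorem halfBathtubRHS_le (L : ℕ) [NeZero L] (t' ν δ : ℝ) (hδ : δ ≤ 1) :
    ν * ((2 * ⌊(1 - δ) * (L : ℝ) ^ 2 / 2⌋₊ : ℕ) : ℝ) / 2 +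
        ∑ k : TorusSite 2 L,
          bathtubSymbolTT' t' ν (latticeMomentum L k 0) (latticeMomentum L k 1) ≤
      (L : ℝ) ^ 2 * (ν * (1 - δ) / 2 + bzInt (bathtubSymbolTT' t' ν) / (4 * π ^ 2) +
        (|ν| + 2 * π * (1 + 4 * |t'|)) / L) := by
  have hL : 0 < L := Nat.pos_of_ne_zero (NeZero.ne L)
  have hL1 : (1 : ℝ) ≤ L := by exact_mod_cast hL
  have hL0 : (L : ℝ) ≠ 0 := by positivity
  have hπ : (π : ℝ) ≠ 0 := Real.pi_ne_zero
  have hN := nu_mul_particleNumber_le L hδ ν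
  have hS := sum_bathtubSymbolTT'_le t' ν L
  have hν : |ν| ≤ (L : ℝ) * |ν| := le_mul_of_one_le_left (abs_nonneg ν) hL1
  have key : (L : ℝ) ^ 2 * (ν * (1 - δ) / 2 + bzInt (bathtubSymbolTT' t' ν) / (4 * π ^ 2) +
      (|ν| + 2 * π * (1 + 4 * |t'|)) / L) = ν * (1 - δ) * (L : ℝ) ^ 2 / 2 +
      (L : ℝ) ^ 2 / (4 * π ^ 2) * bzInt (bathtubSymbolTT' t' ν) + (L : ℝ) * |ν| +
      2 * π * (1 + 4 * |t'|) * L := by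
    field_simp
    ring
  rw [key]
  linarith

/-! ### The statements -/

/-- **The half-bathtub stiffness ceiling in the thermodynamic limit (`T = 0`).** For `L ≥ 3`,
every `t'`, `U`, `-1 ≤ δ ≤ 1` (`n = 1 - δ`), `ρ_s > 0`, `θ₀ > 0`: if the flux envelope of the
twisted `t–t'` torus is stiff, `E(θ) − E(0) ≥ ρ_s θ²` on `|θ| ≤ θ₀`, then for every `ν`
`ρ_s ≤ ν(1-δ)/2 + (4π²)⁻¹ ∫_{-π}^{π}∫_{-π}^{π} (cos x + cos y + 4t' cos x cos y − ν)⁺ dx dy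
  + (|ν| + 2π(1 + 4|t'|))/L`. PROVED (`halfBathtubStiffnessBoundTL_holds`). The `L → ∞` limit of
the right-hand side, optimised over `ν`, is `s_w(n, t')/2` of EXTREMISERS.md §2 (bounds.tex
Cor. 2.2(iii); HVR19 eq. (3) with the sharp one-body constant). -/
@[conjecture] def HalfBathtubStiffnessBoundTL : Prop :=
  ∀ (L : ℕ) [NeZero L], 3 ≤ L → ∀ (t' U δ ρs θ₀ : ℝ), -1 ≤ δ → δ ≤ 1 → 0 < ρs → 0 < θ₀ →
    (∀ θ : ℝ, |θ| ≤ θ₀ → ρs * θ ^ 2 ≤ fluxEnergyTT' L t' U δ θ - fluxEnergyTT' L t' U δ 0) →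
    ∀ ν : ℝ, ρs ≤ ν * (1 - δ) / 2 +
      (∫ y in (-π)..π, ∫ x in (-π)..π,
          max (Real.cos x + Real.cos y + 4 * t' * (Real.cos x * Real.cos y) - ν) 0) /
          (4 * π ^ 2) +
        (|ν| + 2 * π * (1 + 4 * |t'|)) / L

/-- PROOF of `HalfBathtubStiffnessBoundTL`: the landed finite-torus ceiling
`halfBathtubStiffnessBoundTT'_holds` ∘ `halfBathtubRHS_le`, divided by `L²`. -/
theorem halfBathtubStiffnessBoundTL_holds : HalfBathtubStiffnessBoundTL := by
  intro L _ hL t' U δ ρs θ₀ hδ hδ1 hρs hθ₀ hst ν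
  have hfin := halfBathtubStiffnessBoundTT'_holds L hL t' U δ ρs θ₀ hδ hρs hθ₀ hst ν
  have hrhs := halfBathtubRHS_le L t' ν δ hδ1
  have hL2 : (0 : ℝ) < (L : ℝ) ^ 2 := by
    have : (0 : ℝ) < L := by exact_mod_cast (show 0 < L by omega)
    positivity
  have h := hfin.trans hrhs
  rw [mul_comm] at h
  exact le_of_mul_le_mul_left h hL2

/-- **The thermal half-bathtub stiffness ceiling in the thermodynamic limit (`T > 0`).** Same
conclusion under the thermal stiffness hypothesis `β ρ_s θ² ≤ log Z_p(0) − log Z_p(θ)` on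
`|θ| ≤ θ₀` for the `(N_L, S^z = 0)` coordinate sector `p` (the hypothesis of the landed
`ThermalHalfBathtubStiffnessBoundTT'`). PROVED (`thermalHalfBathtubStiffnessBoundTL_holds`). -/
@[conjecture] def ThermalHalfBathtubStiffnessBoundTL : Prop :=
  ∀ (L : ℕ) [NeZero L], 3 ≤ L → ∀ (t' U δ β ρs θ₀ : ℝ), -1 ≤ δ → δ ≤ 1 → 0 < β → 0 < ρs →
    0 < θ₀ →
    let p : Finset (Orb (FermionTorus 2 L)) → Prop := fun s =>
      s.card = 2 * ⌊(1 - δ) * (L : ℝ) ^ 2 / 2⌋₊ ∧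
        2 * (s.filter fun i => (ofLex i).2 = 0).card = 2 * ⌊(1 - δ) * (L : ℝ) ^ 2 / 2⌋₊
    (∀ θ : ℝ, |θ| ≤ θ₀ → β * ρs * θ ^ 2 ≤
        Real.log (partitionFn β ((hubbardTorusTT'Flux L t' U 0).toBlock p p)).re -
          Real.log (partitionFn β ((hubbardTorusTT'Flux L t' U θ).toBlock p p)).re) →
    ∀ ν : ℝ, ρs ≤ ν * (1 - δ) / 2 +
      (∫ y in (-π)..π, ∫ x in (-π)..π,
          max (Real.cos x + Real.cos y + 4 * t' * (Real.cos x * Real.cos y) - ν) 0) /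
          (4 * π ^ 2) +
        (|ν| + 2 * π * (1 + 4 * |t'|)) / L

/-- PROOF of `ThermalHalfBathtubStiffnessBoundTL` from the landed
`thermalHalfBathtubStiffnessBoundTT'_holds`. -/
theorem thermalHalfBathtubStiffnessBoundTL_holds : ThermalHalfBathtubStiffnessBoundTL := by
  intro L _ hL t' U δ β ρs θ₀ hδ hδ1 hβ hρs hθ₀
  dsimp only
  intro hst ν
  have hfin := thermalHalfBathtubStiffnessBoundTT'_holds L hL t' U δ β ρs θ₀ hδ hβ hρs hθ₀
  dsimp only at hfin
  have hfin' := hfin hst ν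
  have hrhs := halfBathtubRHS_le L t' ν δ hδ1
  have hL2 : (0 : ℝ) < (L : ℝ) ^ 2 := by
    have : (0 : ℝ) < L := by exact_mod_cast (show 0 < L by omega)
    positivity
  have h := hfin'.trans hrhs
  rw [mul_comm] at h
  exact le_of_mul_le_mul_left h hL2

/-! ### The headline constant at half filling -/

/-- The zone mean of the kinetic symbol vanishes: `∫_{-π}^{π}∫_{-π}^{π} w_s = 0`. -/
theorem bzInt_kinSymbol (s : ℝ) : bzInt (kinSymbol s) = 0 := by
  unfold bzInt kinSymbol
  have hcos : ∫ x in (-π)..π, Real.cos x = 0 := by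
    rw [integral_cos, Real.sin_neg, Real.sin_pi]; ring
  have inner : ∀ y, ∫ x in (-π)..π, (2 * (Real.cos x + Real.cos y) +
      8 * s * (Real.cos x * Real.cos y)) = 4 * π * Real.cos y := by
    intro y
    have e : (fun x => 2 * (Real.cos x + Real.cos y) + 8 * s * (Real.cos x * Real.cos y)) =
        fun x => (2 + 8 * s * Real.cos y) * Real.cos x + 2 * Real.cos y := by
      funext x; ring
    have hi1 : IntervalIntegrable (fun x => (2 + 8 * s * Real.cos y) * Real.cos x) volume (-π) π :=
      (continuous_const.mul Real.continuous_cos).intervalIntegrable _ _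
    rw [e, intervalIntegral.integral_add hi1 intervalIntegrable_const,
      intervalIntegral.integral_const_mul, hcos, intervalIntegral.integral_const, smul_eq_mul]
    ring
  simp_rw [inner]
  rw [intervalIntegral.integral_const_mul, hcos, mul_zero]

/-- At `ν = 0` the zone integral of the positive part is `π² · kinL1 t'`
(`(w/2)⁺ = (|w| + w)/4`, `∫∫ w = 0` and `∫∫ |w| = 4π² kinL1`). -/
theorem bzInt_bathtubSymbolTT'_zero (t' : ℝ) :
    bzInt (bathtubSymbolTT' t' 0) = π ^ 2 * kinL1 t' := by
  have hpt : bathtubSymbolTT' t' 0 = fun x y =>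
      (1 / 4) * |kinSymbol t' x y| + (1 / 4) * kinSymbol t' x y := by
    funext x y
    simp only [bathtubSymbolTT', kinSymbol, sub_zero]
    rcases le_or_gt 0 (Real.cos x + Real.cos y + 4 * t' * (Real.cos x * Real.cos y)) with h | h
    · rw [max_eq_left h, abs_of_nonneg (by linarith)]; ring
    · rw [max_eq_right h.le, abs_of_neg (by linarith)]; ring
  rw [hpt, bzInt_add (continuous_const_mul_abs_kinSymbol _ _)
      (continuous_const.mul (continuous_kinSymbol t')), bzInt_const_mul, bzInt_const_mul,
    bzInt_kinSymbol, mul_zero, add_zero]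
  have hk : bzInt (fun x y => |kinSymbol t' x y|) = kinL1 t' * (2 * π) ^ 2 := by
    rw [kinL1, div_mul_cancel₀ _ (by positivity)]
  rw [hk]
  ring

/-- **Headline: the half-filled `t–t'` Hubbard torus.** For `L ≥ 3`, every `t'`, `U`, at half
filling (`δ = 0`): a stiff flux envelope `E(θ) − E(0) ≥ ρ_s θ²` (`|θ| ≤ θ₀`) forces
`ρ_s ≤ kinL1 t' / 4 + 2π(1 + 4|t'|)/L`, with `kinL1` the certified one-body column of
`Bounds/KinSymbolIntegrals.lean` (`kinL1 0 = 16/π²`, `kinL1 s ≤ kinL1 s₀ + (32/π²)|s − s₀|`).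
PROVED (`halfFillingStiffnessCeilingTL_holds`: `ν = 0` in `HalfBathtubStiffnessBoundTL`). -/
@[conjecture] def HalfFillingStiffnessCeilingTL : Prop :=
  ∀ (L : ℕ) [NeZero L], 3 ≤ L → ∀ (t' U ρs θ₀ : ℝ), 0 < ρs → 0 < θ₀ →
    (∀ θ : ℝ, |θ| ≤ θ₀ → ρs * θ ^ 2 ≤ fluxEnergyTT' L t' U 0 θ - fluxEnergyTT' L t' U 0 0) →
    ρs ≤ kinL1 t' / 4 + 2 * π * (1 + 4 * |t'|) / L

/-- PROOF of `HalfFillingStiffnessCeilingTL`. -/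
theorem halfFillingStiffnessCeilingTL_holds : HalfFillingStiffnessCeilingTL := by
  intro L _ hL t' U ρs θ₀ hρs hθ₀ hst
  have h := halfBathtubStiffnessBoundTL_holds L hL t' U 0 ρs θ₀ (by norm_num) (by norm_num)
    hρs hθ₀ hst 0
  have hI : (∫ y in (-π)..π, ∫ x in (-π)..π,
      max (Real.cos x + Real.cos y + 4 * t' * (Real.cos x * Real.cos y) - 0) 0) =
      π ^ 2 * kinL1 t' := bzInt_bathtubSymbolTT'_zero t'
  rw [hI] at h
  have hL0 : (L : ℝ) ≠ 0 := by exact_mod_cast (show L ≠ 0 by omega)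
  have hπ : (π : ℝ) ≠ 0 := Real.pi_ne_zero
  have e : (0 : ℝ) * (1 - 0) / 2 + π ^ 2 * kinL1 t' / (4 * π ^ 2) +
      (|(0 : ℝ)| + 2 * π * (1 + 4 * |t'|)) / L = kinL1 t' / 4 + 2 * π * (1 + 4 * |t'|) / L := by
    rw [abs_zero]
    field_simp
    ring
  linarith [h, e.le, e.ge]

/-- **Headline at `t' = 0`: the half-filled nearest-neighbour Hubbard torus, every `U`**:
`E(θ) − E(0) ≥ ρ_s θ²` on `|θ| ≤ θ₀` for the flux envelope `fluxEnergy L U 0` forces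
`ρ_s ≤ 4/π² + 2π/L` (the thermodynamic-limit constant `4/π² = s_w(1, 0)/2 ≈ 0.405` of BOUNDS.md
C1 plus an explicit finite-size rate). PROVED (`halfFillingStiffnessCeilingHubbardTL_holds`). -/
@[conjecture] def HalfFillingStiffnessCeilingHubbardTL : Prop :=
  ∀ (L : ℕ) [NeZero L], 3 ≤ L → ∀ (U ρs θ₀ : ℝ), 0 < ρs → 0 < θ₀ →
    (∀ θ : ℝ, |θ| ≤ θ₀ → ρs * θ ^ 2 ≤ fluxEnergy L U 0 θ - fluxEnergy L U 0 0) →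
    ρs ≤ 4 / π ^ 2 + 2 * π / L

/-- PROOF of `HalfFillingStiffnessCeilingHubbardTL` (`fluxEnergyTT' L 0 = fluxEnergy L`,
`kinL1_zero`). -/
theorem halfFillingStiffnessCeilingHubbardTL_holds : HalfFillingStiffnessCeilingHubbardTL := by
  intro L _ hL U ρs θ₀ hρs hθ₀ hst
  have h := halfFillingStiffnessCeilingTL_holds L hL 0 U ρs θ₀ hρs hθ₀
    (by simpa only [fluxEnergyTT'_tPrime_zero] using hst)
  rw [kinL1_zero, abs_zero] at h
  have hπ : (π : ℝ) ≠ 0 := Real.pi_ne_zero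
  have e : 16 / π ^ 2 / 4 + 2 * π * (1 + 4 * (0 : ℝ)) / L = 4 / π ^ 2 + 2 * π / L := by
    field_simp
    ring
  linarith [h, e.le, e.ge]

end Summit.HubbardSuperconductivity.HubbardLadder.Bounds
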